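import Summits.Ventures.PercRepro.S1CoreCapSpecSpreadFourLinesF

/-!
# PercRepro — THE INSTANCE `ν = 4` OF THE SPREAD SPEC IS A THEOREM: `FourCapSpecSpread capPaper 4 6` (p1, gen 31)

`proofs/P1-S2-CORANK6.md` §4d–§4e. With two E-lines `E = {a, b, t}`, `E' = {a', b', t}` (parts 1–2), the points of `A ∪ B` off `E ∪ E'` are
exactly `v` (`compl_two_E`: `A = {v, a, a'}`, `B = {v, b, b'}`); a second F-line lies in `F₁ ∪ E ∪ (A ∪ B)` (`F_second_subset_of_E`, part 2),
passes through `t` and meets `A ∪ B` off `E` (`F_through_t`), hence — off `E'` too — at `v`;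
two such F-lines share `{v, t}`: **at most two F-lines when two E-lines exist** (`F_card_le_two_of_two_E`). Every line is `A`, `B`, an E-line or
an F-line, so **at most `2 + 2 + 2` or `2 + 1 + 3` = six simple 3-point lines** (`card_le_six_of_three_points_spread`; the search reads `≤ 5`),
and with the two legs of S1CoreCapSpecSpreadFour the assembly of `fourCapSpec_four` (P1-S4-CAPBRIDGE.md §13) with `8 ↦ 6` gives
**`fourCapSpecSpread_four : FourCapSpecSpread capPaper 4 6`** — the first kernel instance of the spread spec (the search's `Q*_spread(4) = 6`
against `Q*(4) = 8`). Axioms: standard.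
-/



namespace PercRepro

namespace S1

namespace FourCap

variable {β : Type} [DecidableEq β]

section Lines

variable {w : β → ℕ} {ls : Finset (Finset β)}
  (hw1 : ∀ L ∈ ls, ∀ v ∈ L, w v = 1)
  (hcard : ∀ L ∈ ls, L.card = 3)
  (h3 : ∀ L ∈ ls, ∀ L' ∈ ls, L ≠ L' → (L ∩ L').card ≤ 1)
  (h4 : ∀ l : List (Finset β), l.Nodup → (∀ L ∈ l, L ∈ ls) → wsum w (unionL l) ≤ 4 + lineRank l)
  (h7 : ∀ l : List (Finset β), l.Nodup → (∀ L ∈ l, L ∈ ls) → lineRank l ≤ 4 → wsum w (unionL l) ≤ lineRank l + 3)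
include hcard h3 in
/-- **An F-line inside `F₁ ∪ E ∪ (A ∪ B)` passes through the third point `t` of the E-line, and its point on `A ∪ B` is off `E`.** -/
theorem F_through_t {A B E F₁ F₂ : Finset β} {t : β} (hE : E ∈ ls) (hF₁ : F₁ ∈ ls) (hF₂ : F₂ ∈ ls)
    (h2E : F₂ ≠ E) (h21 : F₂ ≠ F₁) (ht : E \ (B ∪ A) = {t}) (hk2 : (F₂ ∩ (B ∪ A)).card ≤ 1)
    (hsub : F₂ ⊆ F₁ ∪ (E ∪ (B ∪ A))) : t ∈ F₂ ∧ ∃ x, F₂ ∩ (B ∪ A) = {x} ∧ x ∉ E := by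
  have hsub' : F₂ ⊆ E ∪ (F₁ ∪ (B ∪ A)) := by
    rw [Finset.union_left_comm]; exact hsub
  obtain ⟨-, i2E, i2BA, -, t2, sd2, -⟩ := F_third_structure hcard h3 hF₁ hE hF₂ h21 h2E hk2 hsub'
  obtain ⟨x, hx⟩ := Finset.card_eq_one.1 i2BA
  -- `F₂ ∖ (E ∪ F₁) = {x}` (a one-point subset of `F₂ ∩ (B ∪ A) = {x}`)
  have hsd : F₂ \ (E ∪ F₁) = {x} := by
    have hs : F₂ \ (E ∪ F₁) ⊆ F₂ ∩ (B ∪ A) := by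
      intro y hy
      exact Finset.mem_inter.2 ⟨(Finset.mem_sdiff.1 hy).1, sd2 hy⟩
    rw [hx] at hs
    exact Finset.eq_of_subset_of_card_le hs (by rw [t2, Finset.card_singleton])
  have hxE : x ∉ E := fun h => by
    have := Finset.mem_sdiff.1 (hsd ▸ Finset.mem_singleton_self x)
    exact this.2 (Finset.mem_union_left _ h)
  refine ⟨?_, x, hx, hxE⟩
  -- the `E`-point of `F₂` is off `B ∪ A`, hence `t`
  obtain ⟨e, he⟩ := Finset.card_eq_one.1 i2E
  have he' := Finset.mem_inter.1 (he ▸ Finset.mem_singleton_self e)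
  have heBA : e ∉ B ∪ A := fun h => by
    have : e ∈ F₂ ∩ (B ∪ A) := Finset.mem_inter.2 ⟨he'.1, h⟩
    rw [hx, Finset.mem_singleton] at this
    exact hxE (this ▸ he'.2)
  have : e ∈ E \ (B ∪ A) := Finset.mem_sdiff.2 ⟨he'.2, heBA⟩
  rw [ht, Finset.mem_singleton] at this
  exact this ▸ he'.1

include h3 in
/-- An E-line meets `B` in exactly one point, which is not on `A` (the mirror of `E_point_on_A`). -/
theorem E_point_on_B {A B E : Finset β} (hA : A ∈ ls) (hB : B ∈ ls) (hE : E ∈ ls) (hEA : E ≠ A) (hEB : E ≠ B)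
    (hk : (E ∩ (B ∪ A)).card = 2) : ∃ b, E ∩ B = {b} ∧ b ∉ A := by
  have hk' : (E ∩ (A ∪ B)).card = 2 := by rw [Finset.union_comm]; exact hk
  exact E_point_on_A h3 hB hA hE hEB hEA hk'

include hw1 hcard h3 h7 in
/-- **With two E-lines, the points of `A ∪ B` off both are exactly `v`** (`A = {v, a, a'}`, `B = {v, b, b'}`). -/
theorem compl_two_E {A B E E' : Finset β} (hA : A ∈ ls) (hB : B ∈ ls) (hE : E ∈ ls) (hE' : E' ∈ ls)
    (hAB : (B ∩ A).card = 1) (hEA : E ≠ A) (hEB : E ≠ B) (hE'A : E' ≠ A) (hE'B : E' ≠ B) (hEE' : E' ≠ E)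
    (hk : (E ∩ (B ∪ A)).card = 2) (hk' : (E' ∩ (B ∪ A)).card = 2) :
    ∀ y ∈ B ∪ A, y ∉ E → y ∉ E' → y ∈ B ∩ A := by
  intro y hy hyE hyE'
  obtain ⟨a, ha, haB⟩ := E_point_on_A h3 hA hB hE hEA hEB hk
  obtain ⟨a', ha', ha'B⟩ := E_point_on_A h3 hA hB hE' hE'A hE'B hk'
  obtain ⟨b, hb, hbA⟩ := E_point_on_B h3 hA hB hE hEA hEB hk
  obtain ⟨b', hb', hb'A⟩ := E_point_on_B h3 hA hB hE' hE'A hE'B hk'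
  have haa' : a ≠ a' := fun h =>
    E_points_ne hw1 hcard h3 h7 hA hB hE hE' hAB hEA hEB hE'A hE'B hEE' hk hk' ha (h ▸ ha')
  have hbb' : b ≠ b' := by
    intro h
    have hk2 : (E ∩ (A ∪ B)).card = 2 := by rw [Finset.union_comm]; exact hk
    have hk2' : (E' ∩ (A ∪ B)).card = 2 := by rw [Finset.union_comm]; exact hk'
    have hAB' : (A ∩ B).card = 1 := by rw [Finset.inter_comm]; exact hAB
    exact E_points_ne hw1 hcard h3 h7 hB hA hE hE' hAB' hEB hEA hE'B hE'A hEE' hk2 hk2' hb (h ▸ hb')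
  have kA := hcard A hA
  have kB := hcard B hB
  rw [Finset.mem_union] at hy
  rw [Finset.mem_inter]
  rcases hy with hyB | hyA
  · -- `y ∈ B ∖ (E ∪ E')`: `B = {b, b'} ∪ (B ∩ A)`
    refine ⟨hyB, ?_⟩
    by_contra hyA
    have hsub : ({y, b, b'} : Finset β) ⊆ B := by
      intro z hz
      simp only [Finset.mem_insert, Finset.mem_singleton] at hz
      rcases hz with rfl | rfl | rfl
      · exact hyB
      · exact (Finset.mem_inter.1 (hb ▸ Finset.mem_singleton_self _)).2
      · exact (Finset.mem_inter.1 (hb' ▸ Finset.mem_singleton_self _)).2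
    have hyb : y ≠ b := fun h => hyE (h ▸ (Finset.mem_inter.1 (hb ▸ Finset.mem_singleton_self _)).1)
    have hyb' : y ≠ b' := fun h => hyE' (h ▸ (Finset.mem_inter.1 (hb' ▸ Finset.mem_singleton_self _)).1)
    have hc := Finset.card_le_card hsub
    rw [Finset.card_insert_of_notMem (by simp [hyb, hyb']), Finset.card_pair hbb'] at hc
    -- `B = {y, b, b'}` and `v ∈ B ∩ A` is none of them
    have heq : ({y, b, b'} : Finset β) = B := Finset.eq_of_subset_of_card_le hsub
      (by rw [Finset.card_insert_of_notMem (by simp [hyb, hyb']), Finset.card_pair hbb']; omega)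
    obtain ⟨v, hv⟩ := Finset.card_eq_one.1 hAB
    have hv' := Finset.mem_inter.1 (hv ▸ Finset.mem_singleton_self v)
    have := hv'.1
    rw [← heq] at this
    simp only [Finset.mem_insert, Finset.mem_singleton] at this
    rcases this with rfl | rfl | rfl
    · exact hyA hv'.2
    · exact hbA hv'.2
    · exact hb'A hv'.2
  · refine ⟨?_, hyA⟩
    by_contra hyB
    have hsub : ({y, a, a'} : Finset β) ⊆ A := by
      intro z hz
      simp only [Finset.mem_insert, Finset.mem_singleton] at hz
      rcases hz with rfl | rfl | rfl
      · exact hyA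
      · exact (Finset.mem_inter.1 (ha ▸ Finset.mem_singleton_self _)).2
      · exact (Finset.mem_inter.1 (ha' ▸ Finset.mem_singleton_self _)).2
    have hya : y ≠ a := fun h => hyE (h ▸ (Finset.mem_inter.1 (ha ▸ Finset.mem_singleton_self _)).1)
    have hya' : y ≠ a' := fun h => hyE' (h ▸ (Finset.mem_inter.1 (ha' ▸ Finset.mem_singleton_self _)).1)
    have hc := Finset.card_le_card hsub
    rw [Finset.card_insert_of_notMem (by simp [hya, hya']), Finset.card_pair haa'] at hc
    have heq : ({y, a, a'} : Finset β) = A := Finset.eq_of_subset_of_card_le hsub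
      (by rw [Finset.card_insert_of_notMem (by simp [hya, hya']), Finset.card_pair haa']; omega)
    obtain ⟨v, hv⟩ := Finset.card_eq_one.1 hAB
    have hv' := Finset.mem_inter.1 (hv ▸ Finset.mem_singleton_self v)
    have := hv'.2
    rw [← heq] at this
    simp only [Finset.mem_insert, Finset.mem_singleton] at this
    rcases this with rfl | rfl | rfl
    · exact hyB hv'.1
    · exact haB hv'.1
    · exact ha'B hv'.1

include hw1 hcard h3 h4 h7 in
/-- **With two E-lines there are at most two F-lines**: the second and third F-lines pass through `t` and through `v`. -/
theorem F_card_le_two_of_two_E {A B E E' : Finset β} (hA : A ∈ ls) (hB : B ∈ ls) (hE : E ∈ ls) (hE' : E' ∈ ls)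
    (hAB : (B ∩ A).card = 1) (hEA : E ≠ A) (hEB : E ≠ B) (hE'A : E' ≠ A) (hE'B : E' ≠ B) (hEE' : E' ≠ E)
    (hk : (E ∩ (B ∪ A)).card = 2) (hk' : (E' ∩ (B ∪ A)).card = 2) :
    (ls.filter (fun L => L ≠ A ∧ L ≠ B ∧ (L ∩ (B ∪ A)).card ≤ 1)).card ≤ 2 := by
  by_contra hlt
  push Not at hlt
  obtain ⟨F₁, F₂, F₃, h1, h2, h3', h12, h13, h23⟩ := Finset.two_lt_card_iff.1 hlt
  simp only [Finset.mem_filter] at h1 h2 h3'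
  have hFE : ∀ F : Finset β, (F ∩ (B ∪ A)).card ≤ 1 → F ≠ E := fun F hF h => by rw [h] at hF; omega
  have hFE' : ∀ F : Finset β, (F ∩ (B ∪ A)).card ≤ 1 → F ≠ E' := fun F hF h => by rw [h] at hF; omega
  have kE := hcard E hE
  have c1 : (E \ (B ∪ A)).card = 1 := by
    have := Finset.card_sdiff_add_card_inter E (B ∪ A)
    omega
  obtain ⟨t, ht⟩ := Finset.card_eq_one.1 c1
  have ht' : E' \ (B ∪ A) = {t} := by
    rw [E_common_third hw1 hcard h7 hA hB hE hE' hAB hEA hEB hE'A hE'B hEE' hk hk']; exact ht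
  have htE' : t ∈ E' := (Finset.mem_sdiff.1 (ht' ▸ Finset.mem_singleton_self t)).1
  have htBA : t ∉ B ∪ A := (Finset.mem_sdiff.1 (ht ▸ Finset.mem_singleton_self t)).2
  have sub2 := F_second_subset_of_E hw1 hcard h3 h4 hA hB hE h1.1 h2.1 hAB hEA hEB h1.2.1 h1.2.2.1 h2.2.1 h2.2.2.1
    (hFE F₁ h1.2.2.2) (hFE F₂ h2.2.2.2) h12.symm hk h1.2.2.2
  have sub3 := F_second_subset_of_E hw1 hcard h3 h4 hA hB hE h1.1 h3'.1 hAB hEA hEB h1.2.1 h1.2.2.1 h3'.2.1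
    h3'.2.2.1 (hFE F₁ h1.2.2.2) (hFE F₃ h3'.2.2.2) h13.symm hk h1.2.2.2
  obtain ⟨ht2, x₂, hx₂, hx₂E⟩ := F_through_t hcard h3 hE h1.1 h2.1 (hFE F₂ h2.2.2.2) h12.symm ht h2.2.2.2 sub2
  obtain ⟨ht3, x₃, hx₃, hx₃E⟩ := F_through_t hcard h3 hE h1.1 h3'.1 (hFE F₃ h3'.2.2.2) h13.symm ht h3'.2.2.2 sub3
  have hx₂' := Finset.mem_inter.1 (hx₂ ▸ Finset.mem_singleton_self x₂)
  have hx₃' := Finset.mem_inter.1 (hx₃ ▸ Finset.mem_singleton_self x₃)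
  have hx₂E' : x₂ ∉ E' := fun h => by
    have := Finset.card_le_one.1 (h3 F₂ h2.1 E' hE' (hFE' F₂ h2.2.2.2)) x₂ (Finset.mem_inter.2 ⟨hx₂'.1, h⟩) t
      (Finset.mem_inter.2 ⟨ht2, htE'⟩)
    exact htBA (this ▸ hx₂'.2)
  have hx₃E' : x₃ ∉ E' := fun h => by
    have := Finset.card_le_one.1 (h3 F₃ h3'.1 E' hE' (hFE' F₃ h3'.2.2.2)) x₃ (Finset.mem_inter.2 ⟨hx₃'.1, h⟩) t
      (Finset.mem_inter.2 ⟨ht3, htE'⟩)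
    exact htBA (this ▸ hx₃'.2)
  have hv₂ := compl_two_E hw1 hcard h3 h7 hA hB hE hE' hAB hEA hEB hE'A hE'B hEE' hk hk' x₂ hx₂'.2 hx₂E hx₂E'
  have hv₃ := compl_two_E hw1 hcard h3 h7 hA hB hE hE' hAB hEA hEB hE'A hE'B hEE' hk hk' x₃ hx₃'.2 hx₃E hx₃E'
  obtain ⟨v, hv⟩ := Finset.card_eq_one.1 hAB
  have e₂ : x₂ = v := Finset.mem_singleton.1 (hv ▸ hv₂)
  have e₃ : x₃ = v := Finset.mem_singleton.1 (hv ▸ hv₃)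
  have hvt : v ≠ t := fun h => htBA (h ▸ Finset.mem_union_left _ (Finset.mem_inter.1 (hv ▸ Finset.mem_singleton_self v)).1)
  have hsub : ({v, t} : Finset β) ⊆ F₃ ∩ F₂ := by
    intro y hy
    simp only [Finset.mem_insert, Finset.mem_singleton] at hy
    rcases hy with rfl | rfl
    · exact Finset.mem_inter.2 ⟨e₃ ▸ hx₃'.1, e₂ ▸ hx₂'.1⟩
    · exact Finset.mem_inter.2 ⟨ht3, ht2⟩
  have := Finset.card_le_card hsub
  rw [Finset.card_pair hvt] at this
  have := h3 F₃ h3'.1 F₂ h2.1 h23.symm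
  omega

include hw1 hcard h3 h4 h7 in
/-- **At most six simple 3-point lines** at nullity `4` under the spread clause. -/
theorem card_le_six_of_three_points_spread : ls.card ≤ 6 := by
  by_contra hlt
  push Not at hlt
  -- two lines meet
  have hmeet : ∃ A ∈ ls, ∃ B ∈ ls, (B ∩ A).card = 1 := by
    by_contra hno
    push Not at hno
    have hdisj : ∀ X ∈ ls, ∀ Y ∈ ls, X ≠ Y → Disjoint X Y := fun X hX Y hY hne => by
      have h1 := h3 X hX Y hY hne
      have h2 := hno Y hY X hX
      rw [Finset.disjoint_iff_inter_eq_empty, ← Finset.card_eq_zero]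
      omega
    obtain ⟨A, B, C, hA, hB, hC, hAB, hAC, hBC⟩ := Finset.two_lt_card_iff.1 (by omega : 2 < ls.card)
    have hB' : B ∈ (ls.erase A) := Finset.mem_erase.2 ⟨hAB.symm, hB⟩
    have hC' : C ∈ ((ls.erase A).erase B) := Finset.mem_erase.2 ⟨hBC.symm, Finset.mem_erase.2 ⟨hAC.symm, hC⟩⟩
    have hpos : 1 < (((ls.erase A).erase B).erase C).card := by
      rw [Finset.card_erase_of_mem hC', Finset.card_erase_of_mem hB', Finset.card_erase_of_mem hA]
      omega
    obtain ⟨D, E, hD, hE, hDE⟩ := Finset.one_lt_card_iff.1 hpos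
    simp only [Finset.mem_erase] at hD hE
    exact not_five_disjoint hw1 hcard h4 hA hB hC hD.2.2.2 hE.2.2.2 (hdisj B hB A hA hAB.symm)
      (hdisj C hC A hA hAC.symm) (hdisj C hC B hB hBC.symm) (hdisj D hD.2.2.2 A hA hD.2.2.1)
      (hdisj D hD.2.2.2 B hB hD.2.1) (hdisj D hD.2.2.2 C hC hD.1) (hdisj E hE.2.2.2 A hA hE.2.2.1)
      (hdisj E hE.2.2.2 B hB hE.2.1) (hdisj E hE.2.2.2 C hC hE.1) (hdisj E hE.2.2.2 D hD.2.2.2 hDE.symm)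
  obtain ⟨A, hA, B, hB, hAB⟩ := hmeet
  have hBA : B ≠ A := by
    rintro rfl
    rw [Finset.inter_self, hcard B hB] at hAB
    omega
  set 𝓔 := ls.filter (fun L => L ≠ A ∧ L ≠ B ∧ (L ∩ (B ∪ A)).card = 2) with h𝓔
  set 𝓕 := ls.filter (fun L => L ≠ A ∧ L ≠ B ∧ (L ∩ (B ∪ A)).card ≤ 1) with h𝓕
  have hcover : ls ⊆ ({A, B} : Finset (Finset β)) ∪ (𝓔 ∪ 𝓕) := by
    intro L hL
    rw [Finset.mem_union, Finset.mem_union, Finset.mem_insert, Finset.mem_singleton]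
    by_cases hLA : L = A
    · exact Or.inl (Or.inl hLA)
    by_cases hLB : L = B
    · exact Or.inl (Or.inr hLB)
    have hk : (L ∩ (B ∪ A)).card ≤ 2 := by
      rw [Finset.inter_union_distrib_left]
      refine (Finset.card_union_le _ _).trans ?_
      have := h3 L hL B hB hLB
      have := h3 L hL A hA hLA
      omega
    rcases (by omega : (L ∩ (B ∪ A)).card = 2 ∨ (L ∩ (B ∪ A)).card ≤ 1) with h | h
    · exact Or.inr (Or.inl (Finset.mem_filter.2 ⟨hL, hLA, hLB, h⟩))
    · exact Or.inr (Or.inr (Finset.mem_filter.2 ⟨hL, hLA, hLB, h⟩))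
  have hc := Finset.card_le_card hcover
  have hu1 := Finset.card_union_le ({A, B} : Finset (Finset β)) (𝓔 ∪ 𝓕)
  have hu2 := Finset.card_union_le 𝓔 𝓕
  have hAB2 : ({A, B} : Finset (Finset β)).card ≤ 2 := Finset.card_le_two
  have hE2 := E_card_le_two hw1 hcard h3 h7 hA hB hAB
  have hF3 := F_card_le_three hw1 hcard h3 h4 h7 hA hB hAB
  rw [← h𝓔] at hE2
  rw [← h𝓕] at hF3
  by_cases hEtwo : 𝓔.card = 2
  · obtain ⟨E, E', hEE', hEq⟩ := Finset.card_eq_two.1 hEtwo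
    have hE : E ∈ 𝓔 := by rw [hEq]; simp
    have hE' : E' ∈ 𝓔 := by rw [hEq]; simp
    rw [h𝓔, Finset.mem_filter] at hE hE'
    have hF2 := F_card_le_two_of_two_E hw1 hcard h3 h4 h7 hA hB hE.1 hE'.1 hAB hE.2.1 hE.2.2.1 hE'.2.1 hE'.2.2.1
      hEE'.symm hE.2.2.2 hE'.2.2.2
    rw [← h𝓕] at hF2
    omega
  · omega

end Lines

/-- **THE INSTANCE `ν = 4` OF THE SPREAD SPEC, PROVED**: `FourCapSpecSpread capPaper 4 6` — the search's `Q*_spread(4) = 6`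
(against `Q*(4) = 8`). Assembly: at most two lines ⟹ `≤ 5` (`cap_add_cap_le_five_spread`); three or more lines ⟹ every line has
weight `≤ 4` (`wsum_le_four_of_two_lt_card`); a line of weight `4` leaves room for at most two others (`card_le_three_of_weight_four_spread`:
`4 + 1 + 1` or `2 + 2 + 2`); otherwise every line is a simple 3-point line of cap `1` and there are at most six (`card_le_six_of_three_points_spread`). -/
theorem fourCapSpecSpread_four : FourCapSpecSpread capPaper 4 6 := by
  intro β _ w ls h1 h2 h3 h4 _ _ h7
  by_cases hbig : 2 < ls.card
  · have hw4 : ∀ L ∈ ls, wsum w L ≤ 4 := wsum_le_four_of_two_lt_card h1 h2 h3 h4 hbig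
    by_cases hex : ∃ L ∈ ls, wsum w L = 4
    · -- a line of weight `4`: at most three lines
      obtain ⟨L₁, hL₁, hwL₁⟩ := hex
      have hm := card_le_three_of_weight_four_spread h1 h2 h3 h4 h7 hL₁ hwL₁
      have hshape : ∀ L ∈ ls, L ≠ L₁ → L.card = 3 ∧ fat w (L \ L₁) = 0 := by
        intro L hL hne
        obtain ⟨L₃, hL₃, h3L, h31⟩ := exists_third hbig hL hL₁ hne
        exact shape_of_weight_four h1 h2 h3 h4 hL₁ hL hL₃ hne h31 h3L hwL₁
      have hcf₁ := wsum_eq_card_add_fat w L₁ (h1 L₁ hL₁)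
      have hk₁ := (h2 L₁ hL₁).1
      rcases (by omega : L₁.card = 4 ∨ L₁.card = 3) with hc4 | hc3
      · -- a simple 4-point line: every other line is a simple 3-point line
        have hf₁ : fat w L₁ = 0 := by omega
        have hothers : ∀ L ∈ ls.erase L₁, capPaper L.card (fat w L) = 1 := by
          intro L hL
          rw [Finset.mem_erase] at hL
          obtain ⟨hc, hf⟩ := hshape L hL.2 hL.1
          have hsplit := fat_sdiff_add_fat_inter w L L₁
          have hmono := fat_mono w (Finset.inter_subset_right : L ∩ L₁ ⊆ L₁)
          have hf0 : fat w L = 0 := by omega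
          rw [hc, hf0]
          decide
        rw [← Finset.add_sum_erase ls _ hL₁, Finset.sum_congr rfl hothers, Finset.sum_const_nat (fun _ _ => rfl),
          Finset.card_erase_of_mem hL₁, hc4, hf₁]
        have : capPaper 4 0 = 4 := by decide
        omega
      · -- a one-fat 3-point line: every line is a 3-point line of cap `≤ 2`
        have hcap : ∀ L ∈ ls, capPaper L.card (fat w L) ≤ 2 := by
          intro L hL
          have hcf := wsum_eq_card_add_fat w L (h1 L hL)
          have hk := (h2 L hL).1
          have hw := hw4 L hL
          have hc : L.card = 3 := by
            by_cases hne : L = L₁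
            · rw [hne]; exact hc3
            · exact (hshape L hL hne).1
          rw [hc]
          exact capPaper_three_le_two (by omega)
        calc ∑ L ∈ ls, capPaper L.card (fat w L) ≤ ∑ L ∈ ls, 2 := Finset.sum_le_sum hcap
          _ = ls.card * 2 := Finset.sum_const_nat (fun _ _ => rfl)
          _ ≤ 6 := by omega
    · -- every line has weight `3`: simple 3-point lines, at most six
      push Not at hex
      have hcard : ∀ L ∈ ls, L.card = 3 := by
        intro L hL
        have := hw4 L hL
        have := hex L hL
        have := card_le_wsum w L (h1 L hL)
        have := (h2 L hL).1
        omega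
      have hfat : ∀ L ∈ ls, fat w L = 0 := by
        intro L hL
        have hcf := wsum_eq_card_add_fat w L (h1 L hL)
        have := hw4 L hL
        have := hex L hL
        have := hcard L hL
        omega
      have hw1 : ∀ L ∈ ls, ∀ v ∈ L, w v = 1 := by
        intro L hL v hv
        rcases h1 L hL v hv with h | h
        · exact h
        · exfalso
          have : 0 < fat w L := by
            unfold fat
            exact Finset.card_pos.2 ⟨v, Finset.mem_filter.2 ⟨hv, h⟩⟩
          have := hfat L hL
          omega
      have hcap : ∀ L ∈ ls, capPaper L.card (fat w L) = 1 := by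
        intro L hL
        rw [hcard L hL, hfat L hL]
        decide
      have hm := card_le_six_of_three_points_spread hw1 hcard h3 h4 h7
      calc ∑ L ∈ ls, capPaper L.card (fat w L) = ∑ L ∈ ls, 1 := Finset.sum_congr rfl hcap
        _ = ls.card := by simp
        _ ≤ 6 := hm
  · push Not at hbig
    rcases (by omega : ls.card = 0 ∨ ls.card = 1 ∨ ls.card = 2) with h0 | hone | htwo
    · rw [Finset.card_eq_zero.1 h0]
      simp
    · obtain ⟨L, rfl⟩ := Finset.card_eq_one.1 hone
      rw [Finset.sum_singleton]
      have hk := h2 L (Finset.mem_singleton_self L)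
      have hcf := wsum_eq_card_add_fat w L (h1 L (Finset.mem_singleton_self L))
      exact (capPaper_le_five hk.1 (by omega)).trans (by omega)
    · obtain ⟨L, L', hne, rfl⟩ := Finset.card_eq_two.1 htwo
      rw [Finset.sum_pair hne]
      exact (cap_add_cap_le_five_spread h1 h2 h3 h7 (by simp) (by simp) hne.symm).trans (by omega)

end FourCap

end S1

end PercRepro
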